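import Mathlib.Analysis.SpecialFunctions.ImproperIntegrals
import Mathlib.Analysis.SpecialFunctions.Trigonometric.ArctanDeriv
import Literature.Barriers.CriticalPhenomena.RigorousRGSmallParameterKatoFormula
import HarnessLib

/-!
# `RigorousRGSmallParameter` (Slade, Theorem 1.4.1): the elementary estimates of §10.1 entering
# the proof of Proposition 3.3.1 — the bound `0 ≤ ρ(s,A) ≲ s^β/(s^β+A)²` on Kato's density and
# the elementary integrals of Lemmas 10.1.3–10.1.4 (instances with `q = 0`)

Companion of `RigorousRGSmallParameterKatoFormula.lean` (Kato's density `ρ^{(β)}(s,a)`,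
`Kato.katoDensity`) in the proof architecture of the barrier `RigorousRGSmallParameter.lean`.
Source: G. Slade, *Critical exponents for long-range `O(n)` models below the upper critical
dimension*, Commun. Math. Phys. 358 (2018) 343–436, §10.1 (arXiv numbering; the journal version
numbers these (10.10), Lemma 10.3, Lemma 10.4): display (10.9) "`0 ≤ ρ(s,A) ≲ s^β/(s^β+A)²`,
`|∂ρ(s,A)/∂A| ≲ s^β/(s^β+A)³`. The first bound is elementary; a proof is given in [Mitt16]";
Lemma 10.1.3 "`I(d,s) = ∫₁^∞ (dt/t)(1/(1+st²))t^{2-d}`. For `s ≥ 1`, `I(d,s) ≲ s⁻¹`. For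
`s ≤ 1`, `I(d,s) ≲ 1 (d > 2), log s⁻¹ (d = 2), s^{-1/2} (d = 1)`" with its proof ("with
`τ = s^{1/2}t` … The integral converges at `∞`, diverges logarithmically at `0` for `d = 2`, and
converges at `0` for `d = 1`"); and Lemma 10.1.4 "`I_1(γ,β,q,A) = ∫₀¹ds s^γ/(s^β+A)^{2+q}`,
`I_2(γ,β,q,A) = ∫₁^∞ds s^γ/(s^β+A)^{2+q}` … Let `r = (2+q)-(γ+1)/β` … `I_1 ≲ 1 (A ≤ 1, r < 0)`,
`A^{-(2+q)} (A ≥ 1, γ > -1)`; `I_2 ≲ 1 (A ≤ 1, r > 0)`, `A^{-r} (A ≥ 1, r > 0)`" with its proof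
("For `r < 0` and `A ≤ 1`, the integral converges when `A = 0`, so `I_1 ≲ 1` … For `I_1` and
`A ≥ 1`, the estimate follows from the inequality `(σ^β+A)^{-2-q} ≤ A^{-2-q}` … For `I_2` … For
`A ≤ 1`, the integral converges if `A = 0`").

## What this file proves (everything; no definition and no named fact is introduced)

* `Kato.one_add_cos_pos`, `Kato.katoDenom_ge_sq` (`s^{2β}+a²+2as^βcos πβ ≥ ½(1+cos πβ)(s^β+a)²`),
  **`Kato.katoDensity_le_rpow_div_sq`** — (10.9), first bound, `q = 0`, with an explicit constant:
  `ρ^{(β)}(s,a) ≤ (2 sin πβ/(π(1+cos πβ))) · s^β/(s^β+a)²` (`β ∈ (0,1)`, `a ≥ 0`, `s > 0`).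
* `CovBound.integrableOn_of_nonneg_of_le`, `CovBound.setIntegral_rpow_Ioc_zero`
  (`∫₀^Ts^r = T^{r+1}/(r+1)`), `CovBound.integrableOn_rpow_Ioc_zero`,
  `CovBound.continuousOn_rpow_div_sq`, `CovBound.integrableOn_rpow_div_sq_Ioc/Ioi`
  (integrability of `s^γ/(s^β+A)²` on `(0,T]` for `γ-2β > -1`, on `(T,∞)` for `γ-2β < -1`).
* **Lemma 10.1.4 for `q = 0`, PROVED in the instances used for (10.3)** (explicit constants,
  general endpoints `T` absorbing the change of variables `s = σL^{-2(j-1)}` of (10.16)):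
  `CovBound.setIntegral_rpow_div_sq_Ioc_le` (`∫₀^T s^γ/(s^β+A)² ≤ T^{γ-2β+1}/(γ-2β+1)`, the case
  "`A ≤ 1, r < 0`", valid for all `A ≥ 0`), `CovBound.setIntegral_rpow_div_sq_Ioc_le'`
  (`≤ A⁻²T^{γ+1}/(γ+1)`, the case "`A ≥ 1, γ > -1`"), `CovBound.setIntegral_rpow_div_sq_Ioi_le`
  (`∫_T^∞ s^γ/(s^β+A)² ≤ T^{γ-2β+1}/(2β-γ-1)`, "`A ≤ 1, r > 0`"),
  `CovBound.setIntegral_rpow_div_sq_Ioi_le'` (`≤ A⁻²T^{γ+1}/(-γ-1)` for `γ < -1`),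
  **`CovBound.setIntegral_rpow_sub_one_div_sq_Ioi`**
  (`I_2(β-1,β,0,A) = 1/(β(1+A))` exactly, the instance `γ = β-1`, `r = 1` of "`A^{-r} (A ≥ 1)`").
  Scope caveat on the printed `I_2 ≲ A^{-r}` (`A ≥ 1`, `r > 0`): its proof ("since the integral
  converges at zero") needs `γ > -1`; for `γ < -1` (the instance `γ = β-p`, `p ≥ 2`, of (10.17))
  one has instead `I_2 ≍ A^{-(2+q)}` for large `A`, which is what `…_Ioi_le'` records and is all
  that (10.3) uses.
* **Lemma 10.1.3, PROVED in the instances `d = 1, 2`** (the `t`-integrals of (10.16), taken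
  from `½` as there, uniformly in the upper limit): `CovBound.setIntegral_inv_one_add_mul_sq_le`
  (`∫_{½}^B dt/(1+σt²) ≤ (π/2)σ^{-1/2}`, the case `d = 1`),
  `CovBound.setIntegral_inv_mul_one_add_mul_sq_eq/_le` (`∫_{½}^B dt/(t(1+σt²)) ≤ ½log((4+σ)/σ)`,
  the case `d = 2`: "diverges logarithmically") and `CovBound.log_le_rpow_neg`
  (`½log((4+σ)/σ) ≤ (5^ε/2ε)σ^{-ε}` for `σ ≤ 1`). Scope caveat: as printed, the case `d = 2`,
  `s ≤ 1` reads `I(2,s) ≲ log s⁻¹`, which fails as `s → 1` (`I(2,1) > 0 = log 1`); the bound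
  proved here is the correct `≲ 1 + log s⁻¹` form. The case `d ≥ 3` (`I(d,s) ≲ 1`) is
  `FRD.scaleIntegral_le` of `RigorousRGSmallParameterFRDScaleBounds`.
-/

noncomputable section

namespace Literature.Barriers.CriticalPhenomena

open _root_.MeasureTheory Set Filter
open scoped _root_.Topology Real

namespace LongRangePhi4

/-! ### (10.9): `ρ(s,A) ≲ s^β/(s^β+A)²` -/

namespace Kato

/-- `1 + cos πβ > 0` for `β ∈ (0,1)` (`= 2cos²(πβ/2)`). [folklore] -/
theorem one_add_cos_pos {β : ℝ} (hβ0 : 0 < β) (hβ1 : β < 1) : 0 < 1 + Real.cos (π * β) := by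
  have hπ := Real.pi_pos
  have h := Real.cos_sq (π * β / 2)
  have e : 2 * (π * β / 2) = π * β := by ring
  rw [e] at h
  have hc : 0 < Real.cos (π * β / 2) :=
    Real.cos_pos_of_mem_Ioo ⟨by nlinarith, by nlinarith⟩
  nlinarith [pow_pos hc 2]

/-- The denominator of `ρ^{(β)}` dominates a square:
`s^{2β} + a² + 2as^β cos πβ ≥ ½(1+cos πβ)(s^β+a)²` (the difference is `½(1-cos πβ)(s^β-a)²`).
[folklore] -/
theorem katoDenom_ge_sq (β a : ℝ) {s : ℝ} (hs : 0 < s) :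
    (1 + Real.cos (π * β)) / 2 * (s ^ β + a) ^ 2 ≤
      s ^ (2 * β) + a ^ 2 + 2 * a * s ^ β * Real.cos (π * β) := by
  have h2 : s ^ (2 * β) = (s ^ β) ^ 2 := by rw [mul_comm, Real.rpow_mul hs.le, Real.rpow_two]
  rw [h2]
  nlinarith [mul_nonneg (sub_nonneg.2 (Real.cos_le_one (π * β))) (sq_nonneg (s ^ β - a))]

/-- **Slade (10.9), first bound, PROVED with an explicit constant**:
`0 ≤ ρ^{(β)}(s,a) ≤ (2 sin πβ/(π(1+cos πβ))) · s^β/(s^β+a)²` for `β ∈ (0,1)`, `a ≥ 0`, `s > 0`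
("The first bound is elementary; a proof is given in [Mitt16]"; positivity is
`Kato.katoDensity_pos`). [cite: Slade2017, §10.1 (display (10.9), first bound)] -/
theorem katoDensity_le_rpow_div_sq {β : ℝ} (hβ0 : 0 < β) (hβ1 : β < 1) {a : ℝ} (ha : 0 ≤ a)
    {s : ℝ} (hs : 0 < s) :
    katoDensity β a s ≤
      2 * Real.sin (π * β) / (π * (1 + Real.cos (π * β))) * (s ^ β / (s ^ β + a) ^ 2) := by
  have hsin : 0 < Real.sin (π * β) := Real.sin_pos_of_pos_of_lt_pi (by positivity)
    (by nlinarith [Real.pi_pos])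
  have hκ := one_add_cos_pos hβ0 hβ1
  have hsb : 0 < s ^ β := Real.rpow_pos_of_pos hs _
  have hD := katoDenom_ge_sq β a hs
  have hπ := Real.pi_pos
  have hsq : 0 < (1 + Real.cos (π * β)) / 2 * (s ^ β + a) ^ 2 := by positivity
  unfold katoDensity
  calc Real.sin (π * β) / π * (s ^ β / (s ^ (2 * β) + a ^ 2 + 2 * a * s ^ β * Real.cos (π * β)))
      ≤ Real.sin (π * β) / π * (s ^ β / ((1 + Real.cos (π * β)) / 2 * (s ^ β + a) ^ 2)) := by
        gcongr
    _ = 2 * Real.sin (π * β) / (π * (1 + Real.cos (π * β))) * (s ^ β / (s ^ β + a) ^ 2) := by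
        have : (s ^ β + a) ^ 2 ≠ 0 := by positivity
        field_simp

end Kato

/-! ### Lemma 10.1.4 (`q = 0`): the mass integrals `I_1`, `I_2` -/

namespace CovBound

/-- A nonnegative continuous function dominated by an integrable one is integrable. [folklore] -/
theorem integrableOn_of_nonneg_of_le {S : Set ℝ} (hS : MeasurableSet S) {f g : ℝ → ℝ}
    (hf : ContinuousOn f S) (hg : IntegrableOn g S) (h : ∀ s ∈ S, 0 ≤ f s ∧ f s ≤ g s) :
    IntegrableOn f S :=
  Integrable.mono' hg (hf.aestronglyMeasurable hS) ((ae_restrict_iff' hS).2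
    (Eventually.of_forall fun s hs => by
      rw [Real.norm_eq_abs, abs_of_nonneg (h s hs).1]
      exact (h s hs).2))

/-- `∫₀^T s^r ds = T^{r+1}/(r+1)` for `r > -1`, `T ≥ 0`. [folklore] -/
theorem setIntegral_rpow_Ioc_zero {r T : ℝ} (hr : -1 < r) (hT : 0 ≤ T) :
    ∫ s in Ioc (0 : ℝ) T, s ^ r = T ^ (r + 1) / (r + 1) := by
  rw [← intervalIntegral.integral_of_le hT, integral_rpow (Or.inl hr),
    Real.zero_rpow (by linarith), sub_zero]

/-- `s ↦ s^r` is integrable on `(0,T]` for `r > -1`. [folklore] -/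
theorem integrableOn_rpow_Ioc_zero {r T : ℝ} (hr : -1 < r) (hT : 0 ≤ T) :
    IntegrableOn (fun s : ℝ => s ^ r) (Ioc 0 T) :=
  (intervalIntegrable_iff_integrableOn_Ioc_of_le hT).1
    (intervalIntegral.intervalIntegrable_rpow' hr)

/-- The integrand `s^γ/(s^β+A)²` is continuous on `(0,∞)` (`A ≥ 0`). [folklore] -/
theorem continuousOn_rpow_div_sq {γ β A : ℝ} (hA : 0 ≤ A) {S : Set ℝ} (hS : S ⊆ Ioi 0) :
    ContinuousOn (fun s : ℝ => s ^ γ / (s ^ β + A) ^ 2) S := by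
  intro s hs
  have hs0 : 0 < s := hS hs
  refine ContinuousAt.continuousWithinAt ?_
  have h1 : ContinuousAt (fun s : ℝ => s ^ γ) s := Real.continuousAt_rpow_const _ _ (Or.inl hs0.ne')
  have h2 : ContinuousAt (fun s : ℝ => s ^ β) s := Real.continuousAt_rpow_const _ _ (Or.inl hs0.ne')
  exact h1.div ((h2.add continuousAt_const).pow 2)
    (pow_pos (add_pos_of_pos_of_nonneg (Real.rpow_pos_of_pos hs0 _) hA) 2).ne'

/-- Pointwise: `s^γ/(s^β+A)² ≤ s^{γ-2β}` (`s > 0`, `A ≥ 0`). [folklore] -/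
theorem rpow_div_sq_le_rpow_sub {γ β A s : ℝ} (hs : 0 < s) (hA : 0 ≤ A) :
    s ^ γ / (s ^ β + A) ^ 2 ≤ s ^ (γ - 2 * β) := by
  have hsb : 0 < s ^ β := Real.rpow_pos_of_pos hs _
  have h2 : s ^ (2 * β) = (s ^ β) ^ 2 := by rw [mul_comm, Real.rpow_mul hs.le, Real.rpow_two]
  rw [Real.rpow_sub hs, h2]
  apply div_le_div_of_nonneg_left (Real.rpow_nonneg hs.le _) (by positivity)
  exact pow_le_pow_left₀ hsb.le (by linarith) 2

/-- Pointwise: `s^γ/(s^β+A)² ≤ A⁻² s^γ` (`s > 0`, `A > 0`). [folklore] -/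
theorem rpow_div_sq_le_inv_sq_mul {γ β A s : ℝ} (hs : 0 < s) (hA : 0 < A) :
    s ^ γ / (s ^ β + A) ^ 2 ≤ A⁻¹ ^ 2 * s ^ γ := by
  have hsb : 0 < s ^ β := Real.rpow_pos_of_pos hs _
  rw [inv_pow, inv_mul_eq_div]
  apply div_le_div_of_nonneg_left (Real.rpow_nonneg hs.le _) (by positivity)
  exact pow_le_pow_left₀ hA.le (by linarith) 2

/-- `s^γ/(s^β+A)²` is integrable on `(0,T]` when `γ - 2β > -1` (`A ≥ 0`). [folklore] -/
theorem integrableOn_rpow_div_sq_Ioc {γ β A T : ℝ} (hγ : -1 < γ - 2 * β) (hA : 0 ≤ A)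
    (hT : 0 ≤ T) : IntegrableOn (fun s : ℝ => s ^ γ / (s ^ β + A) ^ 2) (Ioc 0 T) :=
  integrableOn_of_nonneg_of_le measurableSet_Ioc (continuousOn_rpow_div_sq hA fun _ hs => hs.1)
    (integrableOn_rpow_Ioc_zero hγ hT) fun _ hs =>
    ⟨div_nonneg (Real.rpow_nonneg hs.1.le _) (sq_nonneg _), rpow_div_sq_le_rpow_sub hs.1 hA⟩

/-- `s^γ/(s^β+A)²` is integrable on `(T,∞)` when `γ - 2β < -1` (`A ≥ 0`, `T > 0`). [folklore] -/
theorem integrableOn_rpow_div_sq_Ioi {γ β A T : ℝ} (hγ : γ - 2 * β < -1) (hA : 0 ≤ A)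
    (hT : 0 < T) : IntegrableOn (fun s : ℝ => s ^ γ / (s ^ β + A) ^ 2) (Ioi T) :=
  integrableOn_of_nonneg_of_le measurableSet_Ioi
    (continuousOn_rpow_div_sq hA fun _ hs => Set.mem_Ioi.2 (lt_trans hT (Set.mem_Ioi.1 hs)))
    (integrableOn_Ioi_rpow_of_lt hγ hT) fun s hs =>
    have hs0 : (0 : ℝ) < s := lt_trans hT (Set.mem_Ioi.1 hs)
    ⟨div_nonneg (Real.rpow_nonneg hs0.le _) (sq_nonneg _), rpow_div_sq_le_rpow_sub hs0 hA⟩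

/-- **Lemma 10.1.4, `I_1`, case "`A ≤ 1, r < 0`" (`q = 0`), PROVED for all `A ≥ 0` and any
upper limit `T ≥ 0`**: `∫₀^T s^γ/(s^β+A)² ds ≤ T^{γ-2β+1}/(γ-2β+1)` when `γ - 2β > -1` ("the
integral converges when `A = 0`"; `T = 1` is the printed `I_1 ≲ 1`, general `T` absorbs the
change of variables `s = σL^{-2(j-1)}` of (10.16)). [cite: Slade2017, §10.1 (Lemma 10.1.4, I_1, case A ≤ 1, r < 0)] -/
theorem setIntegral_rpow_div_sq_Ioc_le {γ β A T : ℝ} (hγ : -1 < γ - 2 * β) (hA : 0 ≤ A)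
    (hT : 0 ≤ T) :
    ∫ s in Ioc (0 : ℝ) T, s ^ γ / (s ^ β + A) ^ 2 ≤ T ^ (γ - 2 * β + 1) / (γ - 2 * β + 1) := by
  rw [← setIntegral_rpow_Ioc_zero hγ hT]
  have hg := integrableOn_rpow_Ioc_zero hγ hT
  have hpt : ∀ s ∈ Ioc (0 : ℝ) T, 0 ≤ s ^ γ / (s ^ β + A) ^ 2 ∧
      s ^ γ / (s ^ β + A) ^ 2 ≤ s ^ (γ - 2 * β) := fun s hs =>
    ⟨div_nonneg (Real.rpow_nonneg hs.1.le _) (sq_nonneg _), rpow_div_sq_le_rpow_sub hs.1 hA⟩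
  exact setIntegral_mono_on (integrableOn_of_nonneg_of_le measurableSet_Ioc
    (continuousOn_rpow_div_sq hA fun s hs => hs.1) hg hpt) hg measurableSet_Ioc fun s hs => (hpt s hs).2

/-- **Lemma 10.1.4, `I_1`, case "`A ≥ 1, γ > -1`" (`q = 0`), PROVED for all `A > 0` and any
upper limit `T ≥ 0`**: `∫₀^T s^γ/(s^β+A)² ds ≤ A⁻²T^{γ+1}/(γ+1)` ("from the inequality
`(σ^β+A)^{-2} ≤ A^{-2}`"). [cite: Slade2017, §10.1 (Lemma 10.1.4, I_1, case A ≥ 1)] -/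
theorem setIntegral_rpow_div_sq_Ioc_le' {γ β A T : ℝ} (hγ : -1 < γ) (hA : 0 < A) (hT : 0 ≤ T) :
    ∫ s in Ioc (0 : ℝ) T, s ^ γ / (s ^ β + A) ^ 2 ≤ A⁻¹ ^ 2 * T ^ (γ + 1) / (γ + 1) := by
  have hg := (integrableOn_rpow_Ioc_zero hγ hT).const_mul (A⁻¹ ^ 2)
  have hpt : ∀ s ∈ Ioc (0 : ℝ) T, 0 ≤ s ^ γ / (s ^ β + A) ^ 2 ∧
      s ^ γ / (s ^ β + A) ^ 2 ≤ A⁻¹ ^ 2 * s ^ γ := fun s hs =>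
    ⟨div_nonneg (Real.rpow_nonneg hs.1.le _) (sq_nonneg _), rpow_div_sq_le_inv_sq_mul hs.1 hA⟩
  calc ∫ s in Ioc (0 : ℝ) T, s ^ γ / (s ^ β + A) ^ 2 ≤ ∫ s in Ioc (0 : ℝ) T, A⁻¹ ^ 2 * s ^ γ :=
        setIntegral_mono_on (integrableOn_of_nonneg_of_le measurableSet_Ioc
          (continuousOn_rpow_div_sq hA.le fun s hs => hs.1) hg hpt) hg measurableSet_Ioc
          fun s hs => (hpt s hs).2
    _ = A⁻¹ ^ 2 * T ^ (γ + 1) / (γ + 1) := by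
        rw [integral_const_mul, setIntegral_rpow_Ioc_zero hγ hT]
        ring

/-- **Lemma 10.1.4, `I_2`, case "`A ≤ 1, r > 0`" (`q = 0`), PROVED for all `A ≥ 0` and any
lower limit `T > 0`**: `∫_T^∞ s^γ/(s^β+A)² ds ≤ T^{γ-2β+1}/(2β-γ-1)` when `γ - 2β < -1` ("the
integral converges if `A = 0`"; `T = 1` is the printed `I_2 ≲ 1`).
[cite: Slade2017, §10.1 (Lemma 10.1.4, I_2, case A ≤ 1, r > 0)] -/
theorem setIntegral_rpow_div_sq_Ioi_le {γ β A T : ℝ} (hγ : γ - 2 * β < -1) (hA : 0 ≤ A)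
    (hT : 0 < T) :
    ∫ s in Ioi T, s ^ γ / (s ^ β + A) ^ 2 ≤ T ^ (γ - 2 * β + 1) / (2 * β - γ - 1) := by
  have hval : ∫ s in Ioi T, s ^ (γ - 2 * β) = T ^ (γ - 2 * β + 1) / (2 * β - γ - 1) := by
    rw [integral_Ioi_rpow_of_lt hγ hT]
    have : γ - 2 * β + 1 ≠ 0 := by linarith
    have : 2 * β - γ - 1 ≠ 0 := by linarith
    field_simp
    ring
  rw [← hval]
  have hg : IntegrableOn (fun s : ℝ => s ^ (γ - 2 * β)) (Ioi T) :=
    integrableOn_Ioi_rpow_of_lt hγ hT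
  have hpt : ∀ s ∈ Ioi T, 0 ≤ s ^ γ / (s ^ β + A) ^ 2 ∧
      s ^ γ / (s ^ β + A) ^ 2 ≤ s ^ (γ - 2 * β) := fun s hs =>
    have hs0 : (0 : ℝ) < s := lt_trans hT hs
    ⟨div_nonneg (Real.rpow_nonneg hs0.le _) (sq_nonneg _), rpow_div_sq_le_rpow_sub hs0 hA⟩
  exact setIntegral_mono_on (integrableOn_of_nonneg_of_le measurableSet_Ioi
    (continuousOn_rpow_div_sq hA fun s hs => Set.mem_Ioi.2 (lt_trans hT (Set.mem_Ioi.1 hs)))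
    hg hpt) hg measurableSet_Ioi fun s hs => (hpt s hs).2

/-- **Lemma 10.1.4, `I_2`, large `A` with `γ < -1` (`q = 0`), any lower limit `T > 0`**:
`∫_T^∞ s^γ/(s^β+A)² ds ≤ A⁻²T^{γ+1}/(-γ-1)` — the true large-`A` behaviour `A^{-(2+q)}` of
`I_2` when `γ < -1` (the printed `A^{-r}`, `r = 2-(γ+1)/β > 2`, over-claims in this range: its
proof needs the `σ`-integral to converge at `0`, i.e. `γ > -1`; (10.3) only uses `A^{-2}`).
[cite: Slade2017, §10.1 (Lemma 10.1.4, I_2, case A ≥ 1; proof "since the integral converges at zero")] -/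
theorem setIntegral_rpow_div_sq_Ioi_le' {γ β A T : ℝ} (hγ : γ < -1) (hA : 0 < A) (hT : 0 < T) :
    ∫ s in Ioi T, s ^ γ / (s ^ β + A) ^ 2 ≤ A⁻¹ ^ 2 * T ^ (γ + 1) / (-γ - 1) := by
  have hg : IntegrableOn (fun s : ℝ => A⁻¹ ^ 2 * s ^ γ) (Ioi T) :=
    (integrableOn_Ioi_rpow_of_lt hγ hT).const_mul _
  have hpt : ∀ s ∈ Ioi T, 0 ≤ s ^ γ / (s ^ β + A) ^ 2 ∧
      s ^ γ / (s ^ β + A) ^ 2 ≤ A⁻¹ ^ 2 * s ^ γ := fun s hs =>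
    have hs0 : (0 : ℝ) < s := lt_trans hT hs
    ⟨div_nonneg (Real.rpow_nonneg hs0.le _) (sq_nonneg _), rpow_div_sq_le_inv_sq_mul hs0 hA⟩
  calc ∫ s in Ioi T, s ^ γ / (s ^ β + A) ^ 2 ≤ ∫ s in Ioi T, A⁻¹ ^ 2 * s ^ γ :=
        setIntegral_mono_on (integrableOn_of_nonneg_of_le measurableSet_Ioi
          (continuousOn_rpow_div_sq hA.le fun s hs =>
            Set.mem_Ioi.2 (lt_trans hT (Set.mem_Ioi.1 hs))) hg hpt) hg
          measurableSet_Ioi fun s hs => (hpt s hs).2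
    _ = A⁻¹ ^ 2 * T ^ (γ + 1) / (-γ - 1) := by
        rw [integral_const_mul, integral_Ioi_rpow_of_lt hγ hT]
        have : γ + 1 ≠ 0 := by linarith
        have : -γ - 1 ≠ 0 := by linarith
        field_simp
        ring

/-- **Lemma 10.1.4, `I_2` with `γ = β-1` (`q = 0`, `r = 1`), PROVED exactly**:
`∫₁^∞ s^{β-1}/(s^β+A)² ds = 1/(β(1+A))` for `β > 0`, `A ≥ 0` (substitution `u = s^β`; this is the
instance `I_2(β-1,β,0,A) ≲ 1 ∧ A⁻¹` entering `S_0` and `T_{j,3}` in (10.16)–(10.18)).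
[cite: Slade2017, §10.1 (Lemma 10.1.4, I_2; instances I_2(β-1,β,q,A) of the proof of Proposition 10.1.1)] -/
theorem setIntegral_rpow_sub_one_div_sq_Ioi {β A : ℝ} (hβ : 0 < β) (hA : 0 ≤ A) :
    ∫ s in Ioi (1 : ℝ), s ^ (β - 1) / (s ^ β + A) ^ 2 = 1 / (β * (1 + A)) := by
  -- antiderivative `g(s) = -(1/β)(s^β+A)⁻¹`
  set g : ℝ → ℝ := fun s => -(1 / β) * (s ^ β + A)⁻¹ with hg
  have hpos : ∀ s ∈ Ici (1 : ℝ), 0 < s ^ β + A := fun s hs =>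
    add_pos_of_pos_of_nonneg (Real.rpow_pos_of_pos (lt_of_lt_of_le zero_lt_one hs) _) hA
  have hderiv : ∀ s ∈ Ici (1 : ℝ), HasDerivAt g (s ^ (β - 1) / (s ^ β + A) ^ 2) s := by
    intro s hs
    have hs0 : s ≠ 0 := (lt_of_lt_of_le zero_lt_one hs).ne'
    have h1 : HasDerivAt (fun s : ℝ => s ^ β + A) (β * s ^ (β - 1)) s := by
      simpa using (Real.hasDerivAt_rpow_const (p := β) (Or.inl hs0)).add_const A
    have h2 := (h1.fun_inv (hpos s hs).ne').const_mul (-(1 / β))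
    refine h2.congr_deriv ?_
    have : s ^ β + A ≠ 0 := (hpos s hs).ne'
    field_simp
  have hnn : ∀ s ∈ Ioi (1 : ℝ), 0 ≤ s ^ (β - 1) / (s ^ β + A) ^ 2 := fun s hs =>
    div_nonneg (Real.rpow_nonneg (lt_trans zero_lt_one hs).le _) (sq_nonneg _)
  have hlim : Tendsto g atTop (𝓝 (-(1 / β) * 0)) := by
    refine Tendsto.const_mul _ ?_
    refine tendsto_inv_atTop_zero.comp ?_
    exact tendsto_atTop_add_const_right _ A (tendsto_rpow_atTop hβ)
  rw [mul_zero] at hlim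
  rw [integral_Ioi_of_hasDerivAt_of_nonneg' hderiv hnn hlim, hg]
  simp only [Real.one_rpow]
  have : (1 : ℝ) + A ≠ 0 := by linarith
  field_simp
  ring

/-! ### Lemma 10.1.3 (`d = 1, 2`): the scale integrals `∫ dt/(t(1+σt²)) t^{2-d}` from `½` -/

/-- **Lemma 10.1.3, `d = 1`, PROVED** (uniformly in the upper limit):
`∫_{(½,B]} dt/(1+σt²) ≤ (π/2)/√σ` for `σ > 0` — "`I(1,s) ≲ s^{-1/2}`" (the printed case `s ≤ 1`;
the bound holds for all `σ > 0`). Antiderivative `σ^{-1/2}arctan(σ^{1/2}t)` ("with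
`τ = s^{1/2}t` … converges at `0` for `d = 1`"). [cite: Slade2017, §10.1 (Lemma 10.1.3, case d = 1)] -/
theorem setIntegral_inv_one_add_mul_sq_le {σ : ℝ} (hσ : 0 < σ) {B : ℝ} (hB : 1 / 2 ≤ B) :
    ∫ t in Ioc (1 / 2 : ℝ) B, (1 + σ * t ^ 2)⁻¹ ≤ π / 2 / Real.sqrt σ := by
  set r : ℝ := Real.sqrt σ with hr
  have hr0 : 0 < r := Real.sqrt_pos.2 hσ
  have hr2 : r ^ 2 = σ := Real.sq_sqrt hσ.le
  have hderiv : ∀ t ∈ uIcc (1 / 2 : ℝ) B,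
      HasDerivAt (fun t : ℝ => r⁻¹ * Real.arctan (r * t)) ((1 + σ * t ^ 2)⁻¹) t := by
    intro t _
    have h1 : HasDerivAt (fun t : ℝ => r * t) r t := by simpa using (hasDerivAt_id t).const_mul r
    have h2 := ((Real.hasDerivAt_arctan' (r * t)).comp t h1).const_mul r⁻¹
    refine h2.congr_deriv ?_
    rw [mul_pow, hr2]
    field_simp
  have hcont : ContinuousOn (fun t : ℝ => (1 + σ * t ^ 2)⁻¹) (uIcc (1 / 2 : ℝ) B) := by
    refine ContinuousOn.inv₀ (by fun_prop) fun t _ => ?_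
    positivity
  rw [← intervalIntegral.integral_of_le hB,
    intervalIntegral.integral_eq_sub_of_hasDerivAt hderiv hcont.intervalIntegrable]
  have h1 : Real.arctan (r * B) ≤ π / 2 := (Real.arctan_lt_pi_div_two _).le
  have h2 : 0 ≤ Real.arctan (r * (1 / 2)) := by
    rw [← Real.arctan_zero]
    exact Real.arctan_mono (by positivity)
  rw [div_eq_mul_inv (π / 2), mul_comm (π / 2)]
  calc r⁻¹ * Real.arctan (r * B) - r⁻¹ * Real.arctan (r * (1 / 2))
      ≤ r⁻¹ * Real.arctan (r * B) := by
        have : 0 ≤ r⁻¹ * Real.arctan (r * (1 / 2)) := by positivity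
        linarith
    _ ≤ r⁻¹ * (π / 2) := by gcongr

/-- **Lemma 10.1.3, `d = 2`: the exact value** `∫_{(½,B]} dt/(t(1+σt²)) =
log B - ½log(1+σB²) + log 2 + ½log(1+σ/4)` (`σ > 0`, `B ≥ ½`; antiderivative
`log t - ½log(1+σt²)`). [cite: Slade2017, §10.1 (Lemma 10.1.3, case d = 2: "diverges logarithmically at 0")] -/
theorem setIntegral_inv_mul_one_add_mul_sq_eq {σ : ℝ} (hσ : 0 < σ) {B : ℝ} (hB : 1 / 2 ≤ B) :
    ∫ t in Ioc (1 / 2 : ℝ) B, (t * (1 + σ * t ^ 2))⁻¹ =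
      Real.log B - 1 / 2 * Real.log (1 + σ * B ^ 2) +
        (Real.log 2 + 1 / 2 * Real.log (1 + σ / 4)) := by
  have hderiv : ∀ t ∈ uIcc (1 / 2 : ℝ) B,
      HasDerivAt (fun t : ℝ => Real.log t - 1 / 2 * Real.log (1 + σ * t ^ 2))
        ((t * (1 + σ * t ^ 2))⁻¹) t := by
    intro t ht
    rw [uIcc_of_le hB] at ht
    have ht0 : 0 < t := by linarith [ht.1]
    have hq : 0 < 1 + σ * t ^ 2 := by positivity
    have h1 : HasDerivAt (fun t : ℝ => 1 + σ * t ^ 2) (σ * (2 * t)) t := by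
      have := ((hasDerivAt_pow 2 t).const_mul σ).const_add 1
      simpa [pow_one] using this
    have h2 := (Real.hasDerivAt_log ht0.ne').sub ((h1.log hq.ne').const_mul (1 / 2))
    refine h2.congr_deriv ?_
    field_simp
    ring
  have hcont : ContinuousOn (fun t : ℝ => (t * (1 + σ * t ^ 2))⁻¹) (uIcc (1 / 2 : ℝ) B) := by
    refine ContinuousOn.inv₀ (by fun_prop) fun t ht => ?_
    rw [uIcc_of_le hB] at ht
    have ht0 : 0 < t := by linarith [ht.1]
    positivity
  rw [← intervalIntegral.integral_of_le hB,
    intervalIntegral.integral_eq_sub_of_hasDerivAt hderiv hcont.intervalIntegrable]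
  have e : (1 : ℝ) + σ * (1 / 2) ^ 2 = 1 + σ / 4 := by ring
  rw [e, Real.log_div one_ne_zero two_ne_zero, Real.log_one]
  ring

/-- **Lemma 10.1.3, `d = 2`, PROVED in corrected form** (uniformly in the upper limit):
`∫_{(½,B]} dt/(t(1+σt²)) ≤ ½log((4+σ)/σ)` for `σ > 0`, `B ≥ ½` — for `σ ≤ 1` this is
`≤ ½log 5 + ½log σ⁻¹ ≲ 1 + log σ⁻¹` (the printed `I(2,s) ≲ log s⁻¹` fails as `s → 1`).
[cite: Slade2017, §10.1 (Lemma 10.1.3, case d = 2)] -/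
theorem setIntegral_inv_mul_one_add_mul_sq_le {σ : ℝ} (hσ : 0 < σ) {B : ℝ} (hB : 1 / 2 ≤ B) :
    ∫ t in Ioc (1 / 2 : ℝ) B, (t * (1 + σ * t ^ 2))⁻¹ ≤ 1 / 2 * Real.log ((4 + σ) / σ) := by
  rw [setIntegral_inv_mul_one_add_mul_sq_eq hσ hB]
  have hB0 : 0 < B := by linarith
  have hq : 0 < 1 + σ * B ^ 2 := by positivity
  -- `log B - ½ log(1+σB²) ≤ ½ log σ⁻¹`
  have h1 : Real.log B - 1 / 2 * Real.log (1 + σ * B ^ 2) ≤ 1 / 2 * Real.log σ⁻¹ := by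
    have hB2 : Real.log B = 1 / 2 * Real.log (B ^ 2) := by
      rw [Real.log_pow]
      ring
    rw [hB2, ← mul_sub, ← Real.log_div (by positivity) hq.ne']
    refine mul_le_mul_of_nonneg_left (Real.log_le_log (by positivity) ?_) (by norm_num)
    rw [div_le_iff₀ hq, inv_mul_eq_div, le_div_iff₀ hσ]
    nlinarith
  -- `log 2 + ½ log(1+σ/4) = ½ log(4+σ)`
  have h2 : Real.log 2 + 1 / 2 * Real.log (1 + σ / 4) = 1 / 2 * Real.log (4 + σ) := by
    have e4 : Real.log 4 = 2 * Real.log 2 := by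
      rw [show (4 : ℝ) = 2 ^ 2 by norm_num, Real.log_pow]
      norm_num
    have : (4 : ℝ) + σ = 4 * (1 + σ / 4) := by ring
    rw [this, Real.log_mul (by norm_num) (by positivity), e4]
    ring
  have h3 : 1 / 2 * Real.log σ⁻¹ + 1 / 2 * Real.log (4 + σ) = 1 / 2 * Real.log ((4 + σ) / σ) := by
    rw [← mul_add, ← Real.log_mul (inv_ne_zero hσ.ne') (by positivity)]
    congr 1
    rw [inv_mul_eq_div]
  linarith

/-- The logarithm is dominated by any negative power: for `0 < σ ≤ 1` and `ε > 0`,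
`½log((4+σ)/σ) ≤ (5^ε/(2ε)) σ^{-ε}` (`log y ≤ y^ε/ε`). [folklore] -/
theorem log_le_rpow_neg {σ : ℝ} (hσ : 0 < σ) (hσ1 : σ ≤ 1) {ε : ℝ} (hε : 0 < ε) :
    1 / 2 * Real.log ((4 + σ) / σ) ≤ 5 ^ ε / (2 * ε) * σ ^ (-ε) := by
  have h1 : Real.log ((4 + σ) / σ) ≤ Real.log (5 / σ) :=
    Real.log_le_log (by positivity) (div_le_div_of_nonneg_right (by linarith) hσ.le)
  have h2 : Real.log (5 / σ) ≤ (5 / σ) ^ ε / ε := Real.log_le_rpow_div (by positivity) hε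
  have h3 : (5 / σ : ℝ) ^ ε = 5 ^ ε * σ ^ (-ε) := by
    rw [Real.div_rpow (by norm_num) hσ.le, Real.rpow_neg hσ.le, div_eq_mul_inv]
  rw [h3] at h2
  have : 1 / 2 * Real.log ((4 + σ) / σ) ≤ 1 / 2 * (5 ^ ε * σ ^ (-ε) / ε) := by linarith
  calc 1 / 2 * Real.log ((4 + σ) / σ) ≤ 1 / 2 * (5 ^ ε * σ ^ (-ε) / ε) := this
    _ = 5 ^ ε / (2 * ε) * σ ^ (-ε) := by
        field_simp

end CovBound

end LongRangePhi4

end Literature.Barriers.CriticalPhenomena
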